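/-
COR-CM (cell pub-hodgecm2, stage 2 of the Hodge ladder) — count-neutral KERNEL CENSUS CHECKS (hinted / pre-expanded), degree 16, type ℤ/16
(seat prover-pub-hodgecm2-b23-g35-0, binder prover b23; claim DEG16-CYCLIC; sequel of `CorCM/FaceCensusHintedChecksPre.lean` and
`Census/HexadecicFaceGeneratorsCyclic{A,B,C}.lean`).  Theorems only: linear-time side checks of `FaceCensus.hgen_of_preChecks` decided in the
kernel (`decide +kernel`) against the census data (BY NAME); split across `…ChecksA/B/C.lean` so that each file verifies in < 4 min on the farm.
No definition, no named fact; `Interfaces.lean` (C1), every E term, B01 and `Transposition/*` untouched.  HONEST FRAMING: `HC_CM` is NOT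
proved; nothing here is a headline.  T5: n/a-class (closed Bool identities).
-/
import Summits.HodgeConjecture.CorCM.Census.HexadecicFaceGeneratorsCyclicC
import HarnessLib

/-!
# Degree 16, cyclic type `ℤ/16`: kernel side checks of the census transport — certificates, data chunks 1–7
-/

namespace Summit.HodgeConjecture.CorCM.HexadecicFaceTransport.Cyclic

open Summit.HodgeConjecture.CorCM.Census.FaceSquaresModel (mem flipAt normalize)
open Summit.HodgeConjecture.CorCM.Census.HexadecicFaceGeneratorsCyclic

set_option maxRecDepth 400000 in -- `List.range (2 ^ 16)` in the kernel
set_option maxHeartbeats 4000000 in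
/-- Side check 3″ (CERTIFIED FACES, pre-expanded form), data chunk 1/14: `isFaceB` + `certOKPre` over the generating representatives. [folklore] -/
theorem certsPre_1 : ((certsIdx_1.map expandX).all fun c => Γ.isFaceB c.1 && Γ.certOKPre genReps c.1 c.2.1 c.2.2) = true := by
  decide +kernel

set_option maxRecDepth 400000 in -- `List.range (2 ^ 16)` in the kernel
set_option maxHeartbeats 4000000 in
/-- Side check 3″ (CERTIFIED FACES, pre-expanded form), data chunk 2/14: `isFaceB` + `certOKPre` over the generating representatives. [folklore] -/
theorem certsPre_2 : ((certsIdx_2.map expandX).all fun c => Γ.isFaceB c.1 && Γ.certOKPre genReps c.1 c.2.1 c.2.2) = true := by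
  decide +kernel

set_option maxRecDepth 400000 in -- `List.range (2 ^ 16)` in the kernel
set_option maxHeartbeats 4000000 in
/-- Side check 3″ (CERTIFIED FACES, pre-expanded form), data chunk 3/14: `isFaceB` + `certOKPre` over the generating representatives. [folklore] -/
theorem certsPre_3 : ((certsIdx_3.map expandX).all fun c => Γ.isFaceB c.1 && Γ.certOKPre genReps c.1 c.2.1 c.2.2) = true := by
  decide +kernel

set_option maxRecDepth 400000 in -- `List.range (2 ^ 16)` in the kernel
set_option maxHeartbeats 4000000 in
/-- Side check 3″ (CERTIFIED FACES, pre-expanded form), data chunk 4/14: `isFaceB` + `certOKPre` over the generating representatives. [folklore] -/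
theorem certsPre_4 : ((certsIdx_4.map expandX).all fun c => Γ.isFaceB c.1 && Γ.certOKPre genReps c.1 c.2.1 c.2.2) = true := by
  decide +kernel

set_option maxRecDepth 400000 in -- `List.range (2 ^ 16)` in the kernel
set_option maxHeartbeats 4000000 in
/-- Side check 3″ (CERTIFIED FACES, pre-expanded form), data chunk 5/14: `isFaceB` + `certOKPre` over the generating representatives. [folklore] -/
theorem certsPre_5 : ((certsIdx_5.map expandX).all fun c => Γ.isFaceB c.1 && Γ.certOKPre genReps c.1 c.2.1 c.2.2) = true := by
  decide +kernel

set_option maxRecDepth 400000 in -- `List.range (2 ^ 16)` in the kernel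
set_option maxHeartbeats 4000000 in
/-- Side check 3″ (CERTIFIED FACES, pre-expanded form), data chunk 6/14: `isFaceB` + `certOKPre` over the generating representatives. [folklore] -/
theorem certsPre_6 : ((certsIdx_6.map expandX).all fun c => Γ.isFaceB c.1 && Γ.certOKPre genReps c.1 c.2.1 c.2.2) = true := by
  decide +kernel

set_option maxRecDepth 400000 in -- `List.range (2 ^ 16)` in the kernel
set_option maxHeartbeats 4000000 in
/-- Side check 3″ (CERTIFIED FACES, pre-expanded form), data chunk 7/14: `isFaceB` + `certOKPre` over the generating representatives. [folklore] -/
theorem certsPre_7 : ((certsIdx_7.map expandX).all fun c => Γ.isFaceB c.1 && Γ.certOKPre genReps c.1 c.2.1 c.2.2) = true := by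
  decide +kernel

end Summit.HodgeConjecture.CorCM.HexadecicFaceTransport.Cyclic
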